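import Summits.QuantumFields.YangMills.Theorems.BalabanLadderIRDefectSquaringSharpExtension
import Summits.QuantumFields.YangMills.Theses.DoublingDefect
import HarnessLib

/-!
# The SELF-DUAL BRIDGE: log-convexity of the thermal excess in time; `OneTorusExit ∧ HalfTimeBound ⇒ ColdExit`

Supplier ∕ format result for crux `BalabanLadder.IR` (stmt-QuantumFields-19354, rung R2c; cell ym-ir).  Provenance: ideator seat
ym-ir-idea-13 g0 (lens «control» + «assume no gap» structure, LINE 2 `selfdual-bridge`, workfile `Cruxes/IR/Lines/selfdual_bridge.lean`
7ffb16fef8e8 §1–§3 verbatim, its §0 replaced by the import of the landed `…DefectSquaringSharpExtension`); critic verdict ym-ir-crit-4 g0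
2026-08-28T03:23:44Z **PASS — FORMAT RESULT** («LAND under g9-№2 … import, don't re-declare»); landed by the ideator under director-ym
RULING g9-№2.  Sorry-free; NO Theses-concluding theorem; nothing datum-quantified.

HONEST FRAMING.  Nothing here proves the Yang–Mills mass gap (Clay), a lattice gap, `BalabanLadder.IR`, or items 17753/17754 of route
`DoublingDefect`; R4 (`BalabanUVStability4`) closes only the conditional finite-𝕋⁴ rung `BalabanLadder.UV`.  Everything below is
group-blind bookkeeping (every compact `G`, every `β ≥ 0`).  The open seeds are NOT touched: the file proves `E ⇒ E₁` pointwise and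
`E₁ ∧ H½ ⇒ E`, where `E = ColdPurityBridge.ColdExitSC`, `E₁ = Theses.DoublingDefect.OneTorusExit` (item 17753, OPEN, used only as a
hypothesis) and `H½ = HalfTimeBoundSC` is a NEW hypothesis Prop (bounded half-time excess of a pure symmetric torus — «no Hagedorn pile-up
between temperatures `1/(La)` and `2/(La)`»; expected true for every `G`, carries no confinement content; NOT derivable from reflection
positivity: format remark B-selfdual).

CONTENT.  §1 `exc_midpoint_sq_le`: `x_{m+k+2}² ≤ x_{m+2}·x_{m+2k+2}` for the thermal trace excess of a spectral datum (Cauchy–Schwarz on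
`exists_ratios`; Hardy–Littlewood–Pólya §2.9).  §2 `cold_of_symmetric_halfTime`: symmetric torus `δ^{(L)}(L) ≤ ε ≤ 1/2` and half-time
excess `x_{L−2⌊L/4⌋}(L³) ≤ A` give `δ^{(t)}(4t) ≤ 2(B₀u)e^{B₀u}`, `t = L−⌊L/4⌋`, `u = 2√(2Aε)`, `B₀ = halfTimeBridgeConst = 2·24³` (the landed
`aspectDefect_extension` at aspect `3/4`); `symDefect_le_four_mul_boxDefect`.  §3 Wilson model: `symDefect` (= the inline `δ` of items
17753/17754 by `rfl`), `halfTimeExcess`, `HalfTimeBoundSC`, `symDefect_le_four_mul_coldDefect` (E ⇒ E₁), and the seam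
`coldExitSC_of_oneTorusExit_halfTime : OneTorusExit → HalfTimeBoundSC → ColdExitSC`.  17754 (`DoublingRecursion`, exponent 2) is NOT
reached by this input: k Cauchy–Schwarz steps give exponent `2 − 2^{1−k}`.

References: HardyLittlewoodPolya1952 §2.9–2.10; Luscher1977; OsterwalderSeiler1978; PrivmanFisher1983; BoydEtAl1996, BorsanyiEtAl2012
(`p ≤ p_SB`, the heuristic for `A`); tree `extension_sharp`, `aspectDefect_extension`, `ColdExitSC`, `IR_of_bridge`, `R_holds`.
-/

noncomputable section

open MeasureTheory Filter
open scoped BigOperators Topology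
open Literature.MathematicalPhysics.QuantumFieldTheory Literature.MathematicalPhysics.QuantumLattice
open Summit.QuantumFields.YangMills.Cruxes.IR.ColdPurityBridge (coldDefect ColdExitSC)
open Summit.QuantumFields.YangMills.Theses.DoublingDefect (OneTorusExit)

namespace Summit.QuantumFields.YangMills.Cruxes.IR.AspectBootstrap

section Family

variable {Z : ℕ → ℕ → ℕ → ℕ → ℝ}

/-! ## §1 Log-convexity of the thermal excess in time (Cauchy–Schwarz on the spectral side; sorry-free) -/

/-- **`x_{m+k+2}² ≤ x_{m+2} · x_{m+2k+2}`** — the thermal trace excess `x_t = Σ_{i≠i₀} rᵢ^t` of a spectral datum is log-convex in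
the time: Cauchy–Schwarz with `fᵢ = rᵢ^{(m+2)/2}`, `gᵢ = rᵢ^{(m+2k+2)/2}` (Hardy–Littlewood–Pólya §2.9).  The tree's `exc_two_mul_le_sq`
(`x_{2t} ≤ x_t²`) is the different, `rᵢ ≤ 1`, endpoint statement. -/
theorem exc_midpoint_sq_le {z : ℕ → ℝ} (h : HasSpectralDatum z) (m k : ℕ) :
    exc z (m + k + 2) ^ 2 ≤ exc z (m + 2) * exc z (m + 2 * k + 2) := by
  classical
  obtain ⟨ι, _, r, i₀, hr, -, -, -, hsum⟩ := exists_ratios h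
  set f : ι → ℝ := Function.update (fun i => Real.sqrt (r i) ^ (m + 2)) i₀ 0 with hf
  set g : ι → ℝ := Function.update (fun i => Real.sqrt (r i) ^ (m + 2 * k + 2)) i₀ 0 with hg
  have hf0 : ∀ i, 0 ≤ f i := by
    intro i
    by_cases hi : i = i₀
    · simp [hf, hi]
    · simp only [hf, Function.update_of_ne hi]; positivity
  have hg0 : ∀ i, 0 ≤ g i := by
    intro i
    by_cases hi : i = i₀
    · simp [hg, hi]
    · simp only [hg, Function.update_of_ne hi]; positivity
  have hsq : ∀ i, Real.sqrt (r i) ^ 2 = r i := fun i => Real.sq_sqrt (hr i).1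
  have hf2 : (fun i => f i ^ (2 : ℝ)) = Function.update (fun i => r i ^ (m + 2)) i₀ 0 := by
    funext i
    rw [Real.rpow_two]
    by_cases hi : i = i₀
    · simp [hf, hi]
    · simp only [hf, Function.update_of_ne hi]
      rw [← pow_mul, mul_comm, pow_mul, hsq]
  have hg2 : (fun i => g i ^ (2 : ℝ)) = Function.update (fun i => r i ^ (m + 2 * k + 2)) i₀ 0 := by
    funext i
    rw [Real.rpow_two]
    by_cases hi : i = i₀
    · simp [hg, hi]
    · simp only [hg, Function.update_of_ne hi]
      rw [← pow_mul, mul_comm, pow_mul, hsq]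
  have hfg : (fun i => f i * g i) = Function.update (fun i => r i ^ (m + k + 2)) i₀ 0 := by
    funext i
    by_cases hi : i = i₀
    · simp [hf, hg, hi]
    · simp only [hf, hg, Function.update_of_ne hi]
      rw [← pow_add, show m + 2 + (m + 2 * k + 2) = 2 * (m + k + 2) by ring, pow_mul, hsq]
  set A : ℝ := Real.sqrt (exc z (m + 2)) with hA
  set B : ℝ := Real.sqrt (exc z (m + 2 * k + 2)) with hB
  have hxm : 0 ≤ exc z (m + 2) := exc_nonneg h m
  have hxM : 0 ≤ exc z (m + 2 * k + 2) := exc_nonneg h (m + 2 * k)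
  have hA2 : A ^ (2 : ℝ) = exc z (m + 2) := by rw [Real.rpow_two, hA, Real.sq_sqrt hxm]
  have hB2 : B ^ (2 : ℝ) = exc z (m + 2 * k + 2) := by rw [Real.rpow_two, hB, Real.sq_sqrt hxM]
  have hf_sum : HasSum (fun i => f i ^ (2 : ℝ)) (A ^ (2 : ℝ)) := by rw [hf2, hA2]; exact hsum m
  have hg_sum : HasSum (fun i => g i ^ (2 : ℝ)) (B ^ (2 : ℝ)) := by rw [hg2, hB2]; exact hsum (m + 2 * k)
  obtain ⟨C, hC0, hCle, hC⟩ := Real.inner_le_Lp_mul_Lq_hasSum_of_nonneg Real.HolderConjugate.two_two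
    (Real.sqrt_nonneg _) (Real.sqrt_nonneg _) hf0 hg0 hf_sum hg_sum
  have hmid : HasSum (fun i => f i * g i) (exc z (m + k + 2)) := by rw [hfg]; exact hsum (m + k)
  have hCeq : C = exc z (m + k + 2) := hC.unique hmid
  have hAB : 0 ≤ A * B := mul_nonneg (Real.sqrt_nonneg _) (Real.sqrt_nonneg _)
  calc exc z (m + k + 2) ^ 2 = C ^ 2 := by rw [hCeq]
    _ ≤ (A * B) ^ 2 := pow_le_pow_left₀ hC0 hCle 2
    _ = A ^ 2 * B ^ 2 := by ring
    _ = exc z (m + 2) * exc z (m + 2 * k + 2) := by rw [hA, hB, Real.sq_sqrt hxm, Real.sq_sqrt hxM]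

/-! ## §2 From a pure SYMMETRIC torus plus a bounded half-time excess to a pure cold box (abstract; sorry-free) -/

/-- The bootstrap constant at aspect `3/4`: `2·(4t/q)³ ≤ 2·24³` for `t = L − q`, `q = ⌊L/4⌋`. -/
def halfTimeBridgeConst : ℝ := 27648

/-- **E₁ ∧ H½ ⇒ cold purity, one box** (sorry-free): if the symmetric torus `L⁴` is pure, `δ^{(L)}(L) ≤ ε ≤ 1/2`
(17753's currency), and the half-time excess is bounded, `x_{L−2q}(L³) ≤ A` (`q = ⌊L/4⌋`), then with `t = L − q` the `4:1`-cold box of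
side `4t` is pure: `δ^{(t)}(4t) ≤ 2 (B₀ u) e^{B₀ u}`, `u = 2√(2Aε)`, `B₀ = halfTimeBridgeConst` — Cauchy–Schwarz (`x_t² ≤ x_{L−2q} x_L`)
then the sharp extension at aspect `t/L ≈ 3/4`. -/
theorem cold_of_symmetric_halfTime (hS : IsAxisSymmetric Z) (hT : IsTracePositive Z) {L : ℕ} (hL : 8 ≤ L) {A ε : ℝ}
    (hA : exc (Z L L L) (L - 2 * (L / 4)) ≤ A) (hε : aspectDefect Z L L ≤ ε) (hεh : ε ≤ 1 / 2) :
    aspectDefect Z (4 * (L - L / 4)) (L - L / 4) ≤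
      2 * (halfTimeBridgeConst * (2 * Real.sqrt (2 * A * ε))) * Real.exp (halfTimeBridgeConst * (2 * Real.sqrt (2 * A * ε))) := by
  have hL2 : 2 ≤ L := by omega
  have hz : HasSpectralDatum (Z L L L) := hT L L L hL2 hL2 hL2
  set q := L / 4 with hq
  set t := L - q with ht
  have hq2 : 2 ≤ q := by omega
  have hqL : 4 * q ≤ L := by omega
  have hLq : L ≤ 4 * q + 3 := by omega
  have ht2 : 2 ≤ t := by omega
  have htL : t < L := by omega
  have hL4t : L ≤ 4 * t := by omega
  -- indices in `m + 2` form: `L − 2q = m + 2`, `t = m + q + 2`, `L = m + 2q + 2`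
  obtain ⟨m, hm1, hm2, hm3⟩ : ∃ m, L - 2 * q = m + 2 ∧ t = m + q + 2 ∧ L = m + 2 * q + 2 :=
    ⟨L - 2 * q - 2, by omega, by omega, by omega⟩
  -- purity of the symmetric torus: `x_L ≤ 2 δ ≤ 2 ε`
  obtain ⟨-, -, -, hxδ⟩ := aspectDefect_facts hT (L := L) (t := L) hL2 hL2
  have hxL : exc (Z L L L) L ≤ 2 * ε := by
    have := hxδ (hε.trans hεh)
    linarith
  have hxL0 : 0 ≤ exc (Z L L L) L := by
    have e := exc_nonneg hz (m + 2 * q); rwa [← hm3] at e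
  have hxh0 : 0 ≤ exc (Z L L L) (L - 2 * q) := by
    have e := exc_nonneg hz m; rwa [← hm1] at e
  have hA0 : 0 ≤ A := hxh0.trans hA
  have hε0 : 0 ≤ ε := by
    have := (aspectDefect_facts hT (L := L) (t := L) hL2 hL2).1
    linarith
  -- Cauchy–Schwarz: `x_t² ≤ x_{L−2q} · x_L ≤ A · 2ε`
  have hCS : exc (Z L L L) t ^ 2 ≤ exc (Z L L L) (L - 2 * q) * exc (Z L L L) L := by
    have e := exc_midpoint_sq_le hz m q
    rw [← hm3, ← hm2, ← hm1] at e
    exact e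
  have hxt0 : 0 ≤ exc (Z L L L) t := by
    have e := exc_nonneg hz (m + q); rwa [← hm2] at e
  have hxt2 : exc (Z L L L) t ^ 2 ≤ 2 * A * ε := by
    calc exc (Z L L L) t ^ 2 ≤ exc (Z L L L) (L - 2 * q) * exc (Z L L L) L := hCS
      _ ≤ A * (2 * ε) := mul_le_mul hA hxL hxL0 hA0
      _ = 2 * A * ε := by ring
  have hxt : exc (Z L L L) t ≤ Real.sqrt (2 * A * ε) := by
    calc exc (Z L L L) t = Real.sqrt (exc (Z L L L) t ^ 2) := (Real.sqrt_sq hxt0).symm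
      _ ≤ Real.sqrt (2 * A * ε) := Real.sqrt_le_sqrt hxt2
  -- the defect at time t of the cube L³ is ≤ 2 x_t
  obtain ⟨hδt0, -, hδtx, -⟩ := aspectDefect_facts hT (L := L) (t := t) hL2 ht2
  set u : ℝ := 2 * Real.sqrt (2 * A * ε) with hu
  have hδtu : aspectDefect Z L t ≤ u := by rw [hu]; linarith
  -- sharp extension at aspect t/L to side 4t
  have key := aspectDefect_extension hS hT ht2 htL hL4t
  -- the constant: `4t/(L − t) = 4t/q ≤ 24`
  have hcast : ((L : ℝ) - ((t : ℕ) : ℝ)) = (q : ℝ) := by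
    rw [ht, Nat.cast_sub (by omega : q ≤ L)]; ring
  have hqpos : (0 : ℝ) < q := by exact_mod_cast (show 0 < q by omega)
  have hratio : (((4 * t : ℕ)) : ℝ) / ((L : ℝ) - ((t : ℕ) : ℝ)) ≤ 24 := by
    rw [hcast, div_le_iff₀ hqpos]
    have : ((t : ℕ) : ℝ) ≤ 6 * (q : ℝ) := by exact_mod_cast (show t ≤ 6 * q by omega)
    push_cast; linarith
  have hratio0 : 0 ≤ (((4 * t : ℕ)) : ℝ) / ((L : ℝ) - ((t : ℕ) : ℝ)) := by rw [hcast]; positivity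
  have hB : 2 * ((((4 * t : ℕ)) : ℝ) / ((L : ℝ) - ((t : ℕ) : ℝ))) ^ 3 ≤ halfTimeBridgeConst := by
    have : ((((4 * t : ℕ)) : ℝ) / ((L : ℝ) - ((t : ℕ) : ℝ))) ^ 3 ≤ 24 ^ 3 := pow_le_pow_left₀ hratio0 hratio 3
    unfold halfTimeBridgeConst; linarith
  set B := 2 * ((((4 * t : ℕ)) : ℝ) / ((L : ℝ) - ((t : ℕ) : ℝ))) ^ 3 with hBdef
  have hB0 : 0 ≤ B := by positivity
  have hTQ0 : (0 : ℝ) ≤ halfTimeBridgeConst := by unfold halfTimeBridgeConst; norm_num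
  calc aspectDefect Z (4 * t) t ≤ 2 * (B * aspectDefect Z L t) * Real.exp (B * aspectDefect Z L t) := key
    _ ≤ 2 * (halfTimeBridgeConst * u) * Real.exp (halfTimeBridgeConst * u) := by gcongr

/-- E ⇒ E₁ at one box (the trivial direction, for the record): the symmetric defect is at most `4×` the cold defect,
`δ^{(L)}(L) ≤ 2 x_L ≤ 2 x_{⌊L/4⌋} ≤ 4 δᶜ(L)` (when `δᶜ(L) ≤ 1/2`; trivially otherwise). -/
theorem symDefect_le_four_mul_boxDefect (hT : IsTracePositive Z) {L : ℕ} (hL : 8 ≤ L) :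
    aspectDefect Z L L ≤ 4 * boxDefect Z L := by
  have hL2 : 2 ≤ L := by omega
  have hz : HasSpectralDatum (Z L L L) := hT L L L hL2 hL2 hL2
  rw [boxDefect_eq_aspectDefect]
  obtain ⟨hc0, -, -, hcx⟩ := aspectDefect_facts hT (L := L) (t := L / 4) hL2 (by omega)
  obtain ⟨-, hs1, hsx, -⟩ := aspectDefect_facts hT (L := L) (t := L) hL2 hL2
  by_cases hhalf : 1 / 2 < aspectDefect Z L (L / 4)
  · linarith
  push Not at hhalf
  obtain ⟨k, hk⟩ : ∃ k, L / 4 = k + 2 := ⟨L / 4 - 2, by omega⟩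
  obtain ⟨k', hk'⟩ : ∃ k', L = k' + 2 := ⟨L - 2, by omega⟩
  have hanti : exc (Z L L L) L ≤ exc (Z L L L) (L / 4) := by
    have e := exc_antitone hz (show k ≤ k' by omega)
    rw [← hk, ← hk'] at e
    exact e
  linarith [hcx hhalf]

end Family

/-! ## §3 The model: Props and the seam E₁ ∧ H½ ⇒ E (sorry-free) -/

section Model

variable {G : Type} [Group G] [TopologicalSpace G] [IsTopologicalGroup G] [CompactSpace G]
  [MeasurableSpace G] [BorelSpace G]

/-- The symmetric-torus period-doubling defect `δ_β(L) = 1 − Z_β(L,L,L,2L)/Z_β(L,L,L,L)²` — VERBATIM the `δ` of items 17753/17754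
(their inline `Z β a t` is `wilsonFinTorusPartition r.ρ β a a a t` by `rfl`). -/
def symDefect {N : ℕ} (ρ : G →* Matrix (Fin N) (Fin N) ℂ) (β : ℝ) (L : ℕ) : ℝ :=
  1 - wilsonFinTorusPartition ρ β L L L (2 * L) / wilsonFinTorusPartition ρ β L L L L ^ 2

/-- `symDefect` is the aspect defect at the self-dual time `t = L` (definitional). -/
theorem symDefect_eq {N : ℕ} (ρ : G →* Matrix (Fin N) (Fin N) ℂ) (β : ℝ) (L : ℕ) :
    symDefect ρ β L = aspectDefect (wilsonFinTorusPartition ρ β) L L := rfl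

/-- The **half-time excess** of the cube `L³`: `x_{L−2⌊L/4⌋,β}(L³)` (time `≈ L/2`, temperature `≈ 2/(La)`), the thermal trace excess
`exc` of the landed one-box bookkeeping applied to the Wilson family. -/
def halfTimeExcess {N : ℕ} (ρ : G →* Matrix (Fin N) (Fin N) ℂ) (β : ℝ) (L : ℕ) : ℝ :=
  exc (wilsonFinTorusPartition ρ β L L L) (L - 2 * (L / 4))

/-- E ⇒ E₁ pointwise in the model: `δ_β(L) ≤ 4 δᶜ_β(L)` (`β ≥ 0`, `L ≥ 8`). -/
theorem symDefect_le_four_mul_coldDefect (r : LatticeRep G) {β : ℝ} (hβ : 0 ≤ β) {L : ℕ} (hL : 8 ≤ L) :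
    symDefect r.ρ β L ≤ 4 * coldDefect r.ρ β L :=
  symDefect_le_four_mul_boxDefect (tracePositive r hβ) hL

end Model

/-- **H½ — `HalfTimeBoundSC` (this line's NEW, load-bearing structural stub; crux, rank 3): bounded half-time excess of a pure symmetric
torus.**  For compact simple simply-connected `G` and every lattice representation `r` there are `A, β₁, L₁` such that for all `β ≥ β₁`
and `L ≥ L₁`: if the symmetric torus is `θ₀`-pure, `δ_β(L) ≤ θ₀` (17753's currency; SOME threshold `θ₀ > 0` — the weakest form the seam
needs, typing checklist 4c(iv)), then `x_{L−2⌊L/4⌋,β}(L³) ≤ A`.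
Why it might fail: a Hagedorn-type pile-up of levels between the energy scales `1/L` and `2/L` on pure tori (free energy at `T = 2/(La)`
exceeding every multiple of `T⁴`); nothing rigorous excludes it at weak coupling; the unconditional version is false-looking in the femto
regime (torons).  Expected TRUE for every compact G (Stefan–Boltzmann: `A ≈ exp(1.75 (N²−1) p/p_SB)`): NO confinement content.
Sources: Luscher1982 (femto universe / torons), BoydEtAl1996, BorsanyiEtAl2012 (`p ≤ p_SB` on the lattice), Hagedorn1965. -/
def HalfTimeBoundSC : Prop :=
  ∀ (G : Type) [Group G] [TopologicalSpace G] [IsTopologicalGroup G] [CompactSpace G],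
    IsCompactSimpleLieGroup G → SimplyConnectedSpace G →
    letI : MeasurableSpace G := borel G
    haveI : BorelSpace G := ⟨rfl⟩
    ∀ r : LatticeRep G, ∃ θ₀ : ℝ, 0 < θ₀ ∧ ∃ A β₁ : ℝ, ∃ L₁ : ℕ, ∀ β : ℝ, β₁ ≤ β → ∀ L : ℕ, L₁ ≤ L →
      symDefect r.ρ β L ≤ θ₀ → halfTimeExcess r.ρ β L ≤ A

/-- **THE SEAM: E₁ ∧ H½ ⇒ E** (real proof).  `OneTorusExit` (item 17753, BY NAME) and `HalfTimeBoundSC` give `ColdPurityBridge.ColdExitSC`: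
at the exit scale `L` (symmetric torus `ε₁`-pure) Cauchy–Schwarz puts `x_{L−⌊L/4⌋}(L³) ≤ √(2Aε₁)` and the sharp extension at aspect `3/4`
makes the cold box of side `4(L−⌊L/4⌋) ≥ L` `ε`-pure. -/
theorem coldExitSC_of_oneTorusExit_halfTime (hE₁ : OneTorusExit) (hH : HalfTimeBoundSC) : ColdExitSC := by
  intro G _ _ _ _ hG hsc
  letI : MeasurableSpace G := borel G
  haveI : BorelSpace G := ⟨rfl⟩
  intro r ε hε
  obtain ⟨θ₀, hθ₀, A, β₂, L₁, hA⟩ := hH G hG hsc r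
  set A' : ℝ := max A 1 with hA'
  have hA'1 : 1 ≤ A' := le_max_right _ _
  have hA'0 : 0 < A' := lt_of_lt_of_le one_pos hA'1
  -- target smallness `u := 2 √(2 A' ε₁)` with `2 (B₀ u) e^{B₀ u} ≤ ε`
  set η : ℝ := min 1 (ε / 6) with hη
  have hη0 : 0 < η := by positivity
  have hη1 : η ≤ 1 := min_le_left _ _
  have hηε : η ≤ ε / 6 := min_le_right _ _
  set ε₁ : ℝ := min (min (1 / 8) θ₀) (η ^ 2 / (32 * A' * halfTimeBridgeConst ^ 2)) with hε₁
  have hTQ : (0 : ℝ) < halfTimeBridgeConst := by unfold halfTimeBridgeConst; norm_num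
  have hε₁0 : 0 < ε₁ := by positivity
  have hε₁a : ε₁ ≤ 1 / 8 := (min_le_left _ _).trans (min_le_left _ _)
  have hε₁θ : ε₁ ≤ θ₀ := (min_le_left _ _).trans (min_le_right _ _)
  have hε₁b : ε₁ ≤ η ^ 2 / (32 * A' * halfTimeBridgeConst ^ 2) := min_le_right _ _
  obtain ⟨β₁, hβ₁⟩ := hE₁ G hG hsc r ε₁ hε₁0
  refine ⟨max (max β₁ β₂) 0, fun β hβ L₀ => ?_⟩
  have hb1 : β₁ ≤ β := le_trans (le_trans (le_max_left _ _) (le_max_left _ _)) hβ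
  have hb2 : β₂ ≤ β := le_trans (le_trans (le_max_right _ _) (le_max_left _ _)) hβ
  have hb0 : 0 ≤ β := le_trans (le_max_right _ _) hβ
  obtain ⟨L, hL, hδ⟩ := hβ₁ β hb1 (max (max L₀ L₁) 8)
  have hL0 : L₀ ≤ L := by omega
  have hL1 : L₁ ≤ L := by omega
  have hL8 : 8 ≤ L := by omega
  -- 17753's inline `Z` is `wilsonFinTorusPartition` by `rfl`
  have hδ' : aspectDefect (wilsonFinTorusPartition r.ρ β) L L ≤ ε₁ := hδ
  have hAx : exc (wilsonFinTorusPartition r.ρ β L L L) (L - 2 * (L / 4)) ≤ A' :=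
    le_trans (hA β hb2 L hL1 (le_trans hδ' hε₁θ)) (le_max_left _ _)
  have key := cold_of_symmetric_halfTime (axisSymmetric r β) (tracePositive r hb0) hL8 hAx hδ' (hε₁a.trans (by norm_num))
  refine ⟨4 * (L - L / 4), by omega, ?_⟩
  have h44 : 4 * (L - L / 4) / 4 = L - L / 4 := by omega
  rw [coldDefect_eq_aspectDefect, h44]
  -- arithmetic: u ≤ η / B₀ hence 2 (B₀ u) e^{B₀ u} ≤ 2 η e ≤ 6 η ≤ ε
  set u : ℝ := 2 * Real.sqrt (2 * A' * ε₁) with hu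
  have hu0 : 0 ≤ u := by positivity
  have hprod : 2 * A' * ε₁ ≤ (η / (2 * halfTimeBridgeConst)) ^ 2 := by
    have h1 : 2 * A' * ε₁ ≤ 2 * A' * (η ^ 2 / (32 * A' * halfTimeBridgeConst ^ 2)) :=
      mul_le_mul_of_nonneg_left hε₁b (by positivity)
    have h2 : 2 * A' * (η ^ 2 / (32 * A' * halfTimeBridgeConst ^ 2)) = (η / (2 * halfTimeBridgeConst)) ^ 2 / 4 := by
      field_simp; ring
    have h3 : (η / (2 * halfTimeBridgeConst)) ^ 2 / 4 ≤ (η / (2 * halfTimeBridgeConst)) ^ 2 := by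
      have : 0 ≤ (η / (2 * halfTimeBridgeConst)) ^ 2 := by positivity
      linarith
    linarith
  have hsqrt : Real.sqrt (2 * A' * ε₁) ≤ η / (2 * halfTimeBridgeConst) :=
    (Real.sqrt_le_sqrt hprod).trans (le_of_eq (Real.sqrt_sq (by positivity)))
  have hBu : halfTimeBridgeConst * u ≤ η := by
    rw [hu]
    have := mul_le_mul_of_nonneg_left hsqrt (le_of_lt (mul_pos two_pos hTQ))
    calc halfTimeBridgeConst * (2 * Real.sqrt (2 * A' * ε₁)) = 2 * halfTimeBridgeConst * Real.sqrt (2 * A' * ε₁) := by ring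
      _ ≤ 2 * halfTimeBridgeConst * (η / (2 * halfTimeBridgeConst)) := this
      _ = η := by field_simp
  have hBu0 : 0 ≤ halfTimeBridgeConst * u := by positivity
  have hexp : Real.exp (halfTimeBridgeConst * u) ≤ 3 := by
    have h1 : Real.exp (halfTimeBridgeConst * u) ≤ Real.exp 1 := Real.exp_le_exp.2 (hBu.trans hη1)
    have h2 := Real.exp_one_lt_d9
    linarith
  calc aspectDefect (wilsonFinTorusPartition r.ρ β) (4 * (L - L / 4)) (L - L / 4)
        ≤ 2 * (halfTimeBridgeConst * u) * Real.exp (halfTimeBridgeConst * u) := key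
    _ ≤ 2 * η * 3 := by gcongr
    _ ≤ ε := by linarith

end Summit.QuantumFields.YangMills.Cruxes.IR.AspectBootstrap

end
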